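import Summits.Ventures.Crystal3D.Bulk.L2bHexagonSteps
import Literature.Geometry.DiscreteGeometry.LayerStackings
import HarnessLib

/-!
# L2B, file 1: frames and the frame-free HCP propagation step

HONEST FRAMING. Part of the venture `Summits/Ventures/Crystal3D` (cell `pub-crystal3d`, phase 2), brick of
the radius-2 lemma `RadiusTwoBarlow` (file `Bulk/PositionalOrder.lean`; design `HOME/lean/l2b/DESIGN.md`).
Nothing here is a crystallization claim; everything is elementary geometry of the two close-packed
tangent arrangements in Hales's normalisation (unit balls, contact distance `2`, `kissingShell`), in the
frame `u₁, u₂, w, h e₃` of `Literature/…/LayerShells.lean` (written out in full — this file declares no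
notation and no definition).

## Contents (namespace `Summit.Ventures.Crystal3D.L2B`)

* `neg_mem_of_fcc` — an FCC tangent arrangement is centrally symmetric (an HCP one is not:
  tree lemma `not_centrallySymmetric_of_hcp_range`, so the two patterns exclude each other).
* `inner_holeTriple_one`, `not_mem_holeTriple_neg` — the two hole triples are disjoint.
* `mem_hexagonSet_of_neg_mem` — in an HCP layer shell `layerShell s s` the antipodal pairs are exactly
  the hexagon (the mirror hexagon is the set of `y` with `−y` also in the shell).
* the four hexagonal pairs `(u₁ − u₂, −u₂)`, `(u₂ − u₁, −u₁)` (type `1`) and `(u₁ − u₂, u₁)`,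
  `(u₂ − u₁, u₂)` (type `−1`) completing the eight of `LayerPropagation.lean`, so that the HCP step is
  available in all SIX hexagon directions: `kissingShell_add_eq_layerShell_of_hcp_hexagon`.
* `types_eq_of_adjacent` — adjacent balls of a layer whose shells are layer shells have equal types
  (tree lemma `holeTriple_type_eq_of_adjacent` of `LayerStackings.lean`, both sides).
* `exists_hcp_frame` — at a ball with an HCP tangent arrangement there is a frame in which its shell is
  `layerShell s s`.
* **`kissingShell_add_eq_of_hcp`** — the frame-free HCP step: if `v ∈ V` has an HCP shell, `ζ` and `−ζ`
  both lie in that shell (so `ζ` is a mirror-hexagon direction) and the shell of `v + ζ` is an FCC or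
  HCP pattern, then `kissingShell V (v + ζ) = kissingShell V v`.
-/

noncomputable section

namespace Summit.Ventures.Crystal3D.L2B

open Literature.Geometry.DiscreteGeometry Literature.MathematicalPhysics.StatisticalMechanics
open RealInnerProductSpace

variable {V : Set (EuclideanSpace ℝ (Fin 3))}

/-! ## The two patterns exclude each other -/

/-- An FCC tangent arrangement is centrally symmetric. -/
theorem neg_mem_of_fcc {S : Set (EuclideanSpace ℝ (Fin 3))} (h : IsArrangedIn S fccKissingPattern)
    {y : EuclideanSpace ℝ (Fin 3)} (hy : y ∈ S) : -y ∈ S := by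
  obtain ⟨A, hA⟩ := isArrangedIn_fcc_iff_range.1 h
  exact neg_mem_of_fcc_range hA hy

/-! ## The hole triples are disjoint -/

/-- Inner products inside the basic hole triple are `4/3` or `−2/3`. -/
theorem inner_holeTriple_one {t t' : EuclideanSpace ℝ (Fin 3)} (ht : t ∈ holeTriple 1)
    (ht' : t' ∈ holeTriple 1) : ⟪t, t'⟫ = 4 / 3 ∨ ⟪t, t'⟫ = -2 / 3 := by
  rw [mem_holeTriple_one_iff] at ht ht'
  rcases ht with rfl | rfl | rfl <;> rcases ht' with rfl | rfl | rfl <;>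
    simp only [inner_sub_left, inner_sub_right, inner_frameW_frameW, inner_frameW_frameU,
      inner_frameU_frameW, inner_frameU_frameU, inner_frameW_frameV, inner_frameV_frameW,
      inner_frameV_frameV, inner_frameU_frameV, inner_frameV_frameU] <;>
    norm_num

/-- The hole triples of types `σ` and `−σ` are disjoint (`σ = ±1`). -/
theorem not_mem_holeTriple_neg {σ : ℝ} (hσ : σ = 1 ∨ σ = -1) {t : EuclideanSpace ℝ (Fin 3)}
    (ht : t ∈ holeTriple σ) : t ∉ holeTriple (-σ) := by
  intro ht'
  -- reduce to `σ = 1`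
  have key : ∀ {x : EuclideanSpace ℝ (Fin 3)}, x ∈ holeTriple 1 → x ∈ holeTriple (-1) → False := by
    intro x hx hx'
    have hnx : -x ∈ holeTriple 1 := by rw [neg_mem_holeTriple_iff]; exact hx'
    have hxx : ⟪x, x⟫ = 4 / 3 := inner_self_of_mem_holeTriple (Or.inl rfl) hx
    rcases inner_holeTriple_one hx hnx with h | h
    · rw [inner_neg_right, hxx] at h; norm_num at h
    · rw [inner_neg_right, hxx] at h; norm_num at h
  rcases hσ with rfl | rfl
  · exact key ht ht'
  · rw [neg_neg] at ht'; exact key ht' ht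

/-! ## The mirror hexagon of an HCP layer shell -/

/-- **In an HCP layer shell the antipodal pairs are exactly the hexagon**: if `y` and `−y` both
belong to `layerShell s s` (`s = ±1`) then `y ∈ hexagonSet`. (The polar points `t ± h e₃`,
`t ∈ holeTriple s`, have antipodes `−t ∓ h e₃` with `−t ∈ holeTriple (−s)`, which is disjoint from
`holeTriple s`.) -/
theorem mem_hexagonSet_of_neg_mem {s : ℝ} (hs : s = 1 ∨ s = -1) {y : EuclideanSpace ℝ (Fin 3)}
    (hy : y ∈ layerShell s s) (hy' : -y ∈ layerShell s s) : y ∈ hexagonSet := by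
  rcases mem_layerShell_iff.1 hy with h | h | h
  · exact h
  · -- `y = t + e`, `t ∈ holeTriple s`
    exfalso
    have hy2 : y 2 = layerSpacing := by
      have := apply_two_of_mem_holeTriple h
      simp only [PiLp.sub_apply, frameE_apply_two] at this; linarith
    rcases mem_layerShell_iff.1 hy' with h' | h' | h'
    · have := apply_two_of_mem_hexagonSet h'
      simp only [PiLp.neg_apply, hy2] at this; linarith [layerSpacing_pos]
    · have := apply_two_of_mem_holeTriple h'
      simp only [PiLp.sub_apply, PiLp.neg_apply, hy2, frameE_apply_two] at this
      linarith [layerSpacing_pos]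
    · have e : -y + layerNormal layerSpacing = -(y - layerNormal layerSpacing) := by abel
      rw [e, neg_mem_holeTriple_iff] at h'
      exact not_mem_holeTriple_neg hs h h'
  · -- `y = t - e`, `t ∈ holeTriple s`
    exfalso
    have hy2 : y 2 = -layerSpacing := by
      have := apply_two_of_mem_holeTriple h
      simp only [PiLp.add_apply, frameE_apply_two] at this; linarith
    rcases mem_layerShell_iff.1 hy' with h' | h' | h'
    · have := apply_two_of_mem_hexagonSet h'
      simp only [PiLp.neg_apply, hy2] at this; linarith [layerSpacing_pos]
    · have e : -y - layerNormal layerSpacing = -(y + layerNormal layerSpacing) := by abel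
      rw [e, neg_mem_holeTriple_iff] at h'
      exact not_mem_holeTriple_neg hs h h'
    · have := apply_two_of_mem_holeTriple h'
      simp only [PiLp.add_apply, PiLp.neg_apply, hy2, frameE_apply_two] at this
      linarith [layerSpacing_pos]

/-- Conversely the hexagon consists of antipodal pairs of any layer shell. -/
theorem neg_mem_layerShell_of_mem_hexagonSet (σ σ' : ℝ) {y : EuclideanSpace ℝ (Fin 3)}
    (hy : y ∈ hexagonSet) : -y ∈ layerShell σ σ' :=
  hexagonSet_subset_layerShell σ σ' (neg_mem_hexagonSet hy)


/-! ## A frame at an HCP ball, and the frame-free HCP step -/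

/-- The shell of `y` in the moved packing `{y | v + L y ∈ V}` is the `L`-preimage of the shell of
`v + L y` in `V` (tree lemma `kissingShell_preimage`, restated for this file's use). -/
theorem kissingShell_moved (v : EuclideanSpace ℝ (Fin 3))
    (L : EuclideanSpace ℝ (Fin 3) ≃ₗᵢ[ℝ] EuclideanSpace ℝ (Fin 3)) (y : EuclideanSpace ℝ (Fin 3)) :
    kissingShell {z | v + L z ∈ V} y = L ⁻¹' kissingShell V (v + L y) :=
  kissingShell_preimage v L V y

/-- **A frame at an HCP ball**: if the shell of `v ∈ V` is an HCP pattern, then after an isometry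
`y ↦ v + L y` of `ℝ³` (for `v ∈ V`) the shell of the origin of the moved packing is a layer shell `layerShell s s`
(`s = ±1`): the mirror hexagon becomes the standard hexagon. -/
theorem exists_hcp_frame (hV : IsUnitBallPacking V) {v : EuclideanSpace ℝ (Fin 3)}
    (h : IsArrangedIn (kissingShell V v) hcpKissingPattern) :
    ∃ L : EuclideanSpace ℝ (Fin 3) ≃ₗᵢ[ℝ] EuclideanSpace ℝ (Fin 3), ∃ s : ℝ, (s = 1 ∨ s = -1) ∧
      kissingShell {y | v + L y ∈ V} 0 = layerShell s s := by
  obtain ⟨L, hH, hns⟩ := exists_frame_of_isArrangedIn_hcp h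
  have hV' := hV.preimage v L
  have hS0 : kissingShell {y | v + L y ∈ V} 0 = L ⁻¹' kissingShell V v := by
    rw [kissingShell_moved]; simp
  have hcp0 : IsArrangedIn (kissingShell {y | v + L y ∈ V} 0) fccKissingPattern ∨
      IsArrangedIn (kissingShell {y | v + L y ∈ V} 0) hcpKissingPattern :=
    Or.inr (by rw [hS0]; exact h.preimage L)
  obtain ⟨σ, σ', hσ, hσ', hST⟩ :=
    (isTwelveConfig_kissingShell_of_isArrangedIn hV' hcp0).eq_layerShell (hS0 ▸ hH)
  have hσσ : σ' = σ := layerShell_types_eq_of_not_symmetric hσ hσ' (by rwa [← hST, hS0])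
  subst hσσ
  exact ⟨L, σ', hσ', hST⟩

/-- **The frame-free HCP step** (Hales, *Dense Sphere Packings* §1.3, localised): if `v ∈ V` has an
HCP tangent arrangement, `ζ` and `−ζ` both belong to its shell (so `ζ` points along the mirror
hexagon), and the tangent arrangement of `v + ζ` is an FCC or HCP pattern, then the shell of `v + ζ`
EQUALS the shell of `v` (same anticuboctahedron, same mirror plane, translated). -/
theorem kissingShell_add_eq_of_hcp (hV : IsUnitBallPacking V) {v ζ : EuclideanSpace ℝ (Fin 3)}
    (hv : v ∈ V) (h : IsArrangedIn (kissingShell V v) hcpKissingPattern) (hζ : ζ ∈ kissingShell V v)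
    (hζ' : -ζ ∈ kissingShell V v)
    (hcp : IsArrangedIn (kissingShell V (v + ζ)) fccKissingPattern ∨
      IsArrangedIn (kissingShell V (v + ζ)) hcpKissingPattern) :
    kissingShell V (v + ζ) = kissingShell V v := by
  obtain ⟨L, s, hs, hS0⟩ := exists_hcp_frame hV h
  have hV' : IsUnitBallPacking {y | v + L y ∈ V} := hV.preimage v L
  have h0 : (0 : EuclideanSpace ℝ (Fin 3)) ∈ {y | v + L y ∈ V} := by simpa using hv
  have hS0' : kissingShell {y | v + L y ∈ V} 0 = L ⁻¹' kissingShell V v := by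
    rw [kissingShell_moved]; simp
  have hz : L.symm ζ ∈ kissingShell {y | v + L y ∈ V} 0 := by rw [hS0']; simpa using hζ
  have hz' : -L.symm ζ ∈ kissingShell {y | v + L y ∈ V} 0 := by rw [hS0']; simpa using hζ'
  rw [hS0] at hz hz'
  have hhex : L.symm ζ ∈ hexagonSet := mem_hexagonSet_of_neg_mem hs hz hz'
  have hSζ : kissingShell {y | v + L y ∈ V} (0 + L.symm ζ) = L ⁻¹' kissingShell V (v + ζ) := by
    rw [zero_add, kissingShell_moved, LinearIsometryEquiv.apply_symm_apply]
  have hcp' : IsArrangedIn (kissingShell {y | v + L y ∈ V} (0 + L.symm ζ)) fccKissingPattern ∨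
      IsArrangedIn (kissingShell {y | v + L y ∈ V} (0 + L.symm ζ)) hcpKissingPattern := by
    rw [hSζ]; exact hcp.imp (fun h => h.preimage L) (fun h => h.preimage L)
  obtain ⟨-, hS⟩ := kissingShell_add_eq_layerShell_of_hcp_hexagon hV' hs h0 hS0 hhex hcp'
  rw [hSζ, ← hS0, hS0'] at hS
  exact (Set.preimage_injective.2 L.surjective) hS

/-! ## Type comparison along a lattice step -/

/-- Adjacent balls `P`, `P + η` (`η = u₁` or `u₂`) whose shells are layer shells have equal types. -/
theorem types_eq_of_adjacent (hV : IsUnitBallPacking V) {P η : EuclideanSpace ℝ (Fin 3)}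
    (hη : η = triangularVec₁ (2 : ℝ) ∨ η = triangularVec₂ (2 : ℝ)) {τ τ' ρ ρ' : ℝ}
    (hτ : τ = 1 ∨ τ = -1) (hτ' : τ' = 1 ∨ τ' = -1) (hρ : ρ = 1 ∨ ρ = -1) (hρ' : ρ' = 1 ∨ ρ' = -1)
    (hP : kissingShell V P = layerShell τ τ') (hQ : kissingShell V (P + η) = layerShell ρ ρ') :
    ρ = τ ∧ ρ' = τ' := by
  constructor
  · refine holeTriple_type_eq_of_adjacent hV (P := P) hη (s := 1) hτ hρ ?_ ?_
    · intro t ht; rw [hP, one_smul]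
      exact mem_layerShell_iff.2 (Or.inr (Or.inl (by simpa using ht)))
    · intro t ht; rw [hQ, one_smul]
      exact mem_layerShell_iff.2 (Or.inr (Or.inl (by simpa using ht)))
  · refine holeTriple_type_eq_of_adjacent hV (P := P) hη (s := -1) hτ' hρ' ?_ ?_
    · intro t ht; rw [hP, neg_one_smul, ← sub_eq_add_neg]
      exact mem_layerShell_iff.2 (Or.inr (Or.inr (by simpa using ht)))
    · intro t ht; rw [hQ, neg_one_smul, ← sub_eq_add_neg]
      exact mem_layerShell_iff.2 (Or.inr (Or.inr (by simpa using ht)))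


end Summit.Ventures.Crystal3D.L2B
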